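import Mathlib

/-!
# NE7EJFlatTransport — row NE7 (node U5), candidate route HOM, variant H1L-EJ, item EJ-1b′ (T1)–(T3′): LENS 1's TRANSPORT STEP (P-EJ-9 NOTE
# §1 (A1)–(A2)) IN KERNEL, ABSTRACTLY — `EF := Cᵀ(1 − c·AᵀA)C ≥ φ(CᵀC)` on ALL 1-forms ⇔ `c·AᵀA ≤ g(CCᵀ)` on `ran C`, for `φ(x) = x·ψ(x)`,
# `g = 1 − ψ`, ψ ANY polynomial; and the variance identity `F·F − (R∕ν)·Σ_P (AF)_P² = (R∕ν)·Σ_P Var_P(F) ≥ 0`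

Lineage `b2b-balaban-t4-ne7-p2` (CRUX PROVER NE7 #2 = C-HOM°'s kernel hand), generation 81; file 119.  Mathlib-only imports (independent of
117 ∕ 118, which supply the block inequality this file consumes as a hypothesis shape).

SOURCE (lens 1, `t4/ideate/NE7/lens1-g67/DEFECT-VS-HESSIAN-NOTE.md` 9e7cf2b6f8adbc99 §1): «(A1) VARIANCE IDENTITY … EF^flat(w) = Σ_a |F_a|² −
¼Σ_P |¼Σ_a m_P(a)F_a|² = 4Σ_P Var_{m_P}(F)» (tent multiset `m_P = (1,2,1)⊗(1,2,1)`, `Σ_a m_P(a) = 16`, partition of unity `Σ_P m_P(a) = 4`);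
«(A2) TRANSPORT.  EF^flat = C†VC, Hess^flat = C†C with C = curl (links → plaquettes), V = 1 − 4A†A (A = tent average).  For φ with
φ(0) = 0 and ψ(x) := φ(x)∕x: … ⟨w, φ(C†C)w⟩ = ⟨Cw, ψ(CC†)Cw⟩ (C φ(C†C) = φ(CC†) C) … Hence EF^flat ≥ φ(Hess^flat) on phys ⇔ 4A†A ≤ g(−Δ_plaq)
on mean-zero plaquette fields, g := 1 − ψ.»  THIS FILE proves the two displayed steps for ARBITRARY real matrices `C : π × κ`, `A : σ × π`
(no lattice, no Fourier analysis):
* §1 **`mul_pow_transpose_mul`** `C·(CᵀC)^k = (CCᵀ)^k·C`, **`mul_aeval_transpose_mul`** `C·ψ(CᵀC) = ψ(CCᵀ)·C` for every polynomial `ψ`,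
  `transpose` companions, and the form identity **`form_phi_eq`** `⟨w, (CᵀC·ψ(CᵀC)) w⟩ = ⟨Cw, ψ(CCᵀ)(Cw)⟩`.
* §2 the defect-form algebra: `EFmat C A c := Cᵀ(1 − c·AᵀA)C`, **`form_EF_eq`** `⟨w, EF w⟩ = ⟨Cw,Cw⟩ − c·⟨A(Cw), A(Cw)⟩`,
  **`transport_iff`**: `(∀ w, ⟨w, φ(CᵀC)w⟩ ≤ ⟨w, EF w⟩) ↔ (∀ w, c·⟨ACw, ACw⟩ ≤ ⟨Cw, g(CCᵀ)(Cw)⟩)` with `φ = X·ψ`, `g = 1 − ψ` — lens 1's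
  «⇔» with `ran C` parametrised by `w`; the one-way forms `transport_of_block` ∕ `block_of_transport`; **`phi_mulVec_eq_zero`** ∕
  **`EF_mulVec_eq_zero`** (both sides kill `ker C` — «gauge modes», so «on all 1-forms» = «on phys»); the flat-sharp cubic instance
  `psiFlat = ½X − ⅛X²` with `aeval_psiFlat` ∕ `aeval_X_mul_psiFlat` (`φ(H) = ½H² − ⅛H³ = ⅛H²(4 − H)`) ∕ `transport_iff_flat`
  (`g(ω) = 1 − (½ω − ⅛ω²)` = file 118's `gFlat`).
* §3 **`variance_identity`**: for weights `m_P(a) ≥ 0` with constant row sum `R` and constant column sum `ν > 0` and `A := m∕R`,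
  `F·F − (R∕ν)Σ_P (AF)_P² = (R∕ν)Σ_P Var_P(F)`, `Var_P(F) := Σ_a A_P(a)F_a² − (Σ_a A_P(a)F_a)² = ½Σ_{a,b} A_P(a)A_P(b)(F_a − F_b)² ≥ 0`
  (`variance_eq_half_sum_sq`, `variance_nonneg`), hence **`form_EF_nonneg`**: `0 ≤ ⟨w, EF w⟩` at `c = R∕ν` (lens 1's `16∕4 = 4`).

HONEST FRAMING: [folklore] matrix algebra; the OBJECTS (curl, tent average, the d = 2 torus) are lens 1's and are NOT constructed here — this
file is the transport skeleton her (A1)–(A2) display, with the block inequality left as the hypothesis files 117–118 discharge at the symbol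
level; nothing of Bałaban's instantiated; NOT (MI₂) at ε > 0, NOT d = 4, NOT a letter move (PRICING-NE7 v50); T-50-10 honoured.  NE7 NOT
PRINTED ∕ NOT PROVED; spine 0∕9; FIXED FINITE T⁴, rung (B)+1; NOT infinite volume, NOT mass gap, NOT Clay.  HONEST DEPENDENCY: continuum YM on
T⁴ ⇐ BetaPertH ∧ nine spine estimates (0/9 proved); BetaPertH ⇐ (D1) ∧ (D4) ∧ CAP+tail; G-an2-4 gates asym, D1 and NE2/3/4.
-/

noncomputable section

open Matrix Finset Polynomial

namespace Summit.QuantumFields.BalabanUV.T4Continuum.NE7EJFlatTransport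

variable {κ π σ : Type*} [Fintype κ] [Fintype π] [Fintype σ] [DecidableEq κ] [DecidableEq π] [DecidableEq σ]

/-! ### §1 Transport of polynomials through `C`: `C·ψ(CᵀC) = ψ(CCᵀ)·C` -/

section Transport

variable (C : Matrix π κ ℝ)

/-- `C·(CᵀC)^k = (CCᵀ)^k·C`. [folklore] -/
theorem mul_pow_transpose_mul (k : ℕ) : C * (Cᵀ * C) ^ k = (C * Cᵀ) ^ k * C := by
  induction k with
  | zero => simp
  | succ k ih => rw [pow_succ, ← Matrix.mul_assoc, ih, Matrix.mul_assoc, ← Matrix.mul_assoc C Cᵀ C, ← Matrix.mul_assoc, ← pow_succ]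

/-- **transport**: `C·ψ(CᵀC) = ψ(CCᵀ)·C` for every real polynomial `ψ` (lens 1 (A2): «C φ(C†C) = φ(CC†) C»). [folklore] -/
theorem mul_aeval_transpose_mul (ψ : ℝ[X]) : C * aeval (Cᵀ * C) ψ = aeval (C * Cᵀ) ψ * C := by
  induction ψ using Polynomial.induction_on' with
  | add p q hp hq => rw [map_add, map_add, Matrix.mul_add, Matrix.add_mul, hp, hq]
  | monomial k a =>
    rw [aeval_monomial, aeval_monomial, ← Matrix.mul_assoc, Algebra.algebraMap_eq_smul_one, Algebra.algebraMap_eq_smul_one,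
      Matrix.mul_smul, Matrix.mul_one, Matrix.smul_mul, Matrix.smul_mul, Matrix.one_mul, Matrix.smul_mul, mul_pow_transpose_mul]

omit [DecidableEq κ] [DecidableEq π] in
/-- `⟨w, Cᵀ M C w⟩ = ⟨Cw, M (Cw)⟩`. [folklore] -/
theorem form_conj (M : Matrix π π ℝ) (w : κ → ℝ) : w ⬝ᵥ ((Cᵀ * M * C) *ᵥ w) = (C *ᵥ w) ⬝ᵥ (M *ᵥ (C *ᵥ w)) := by
  rw [Matrix.mul_assoc, ← mulVec_mulVec, dotProduct_mulVec, vecMul_transpose, mulVec_mulVec]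

/-- `φ(H) = H·ψ(H)` transported: `CᵀC·ψ(CᵀC) = Cᵀ·ψ(CCᵀ)·C`. [folklore] -/
theorem phi_eq_conj (ψ : ℝ[X]) : Cᵀ * C * aeval (Cᵀ * C) ψ = Cᵀ * aeval (C * Cᵀ) ψ * C := by
  rw [Matrix.mul_assoc, mul_aeval_transpose_mul, Matrix.mul_assoc]

/-- **the form identity** `⟨w, φ(CᵀC) w⟩ = ⟨Cw, ψ(CCᵀ)(Cw)⟩` for `φ = X·ψ` (lens 1 (A2): «⟨w, φ(C†C)w⟩ = ⟨Cw, ψ(CC†) Cw⟩»). [folklore] -/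
theorem form_phi_eq (ψ : ℝ[X]) (w : κ → ℝ) :
    w ⬝ᵥ ((Cᵀ * C * aeval (Cᵀ * C) ψ) *ᵥ w) = (C *ᵥ w) ⬝ᵥ (aeval (C * Cᵀ) ψ *ᵥ (C *ᵥ w)) := by
  rw [phi_eq_conj, form_conj]

/-- `φ(H) = aeval H (X·ψ)` is indeed `H·ψ(H)`. [folklore] -/
theorem aeval_X_mul (H : Matrix κ κ ℝ) (ψ : ℝ[X]) : aeval H (X * ψ) = H * aeval H ψ := by
  rw [map_mul, aeval_X]

end Transport

/-! ### §2 The defect form `EF = Cᵀ(1 − c·AᵀA)C` and the transport equivalence -/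

section Defect

variable (C : Matrix π κ ℝ) (A : Matrix σ π ℝ) (c : ℝ)

/-- the abstract one-step defect form `EF := Cᵀ(1 − c·AᵀA)C` (lens 1: `C` = curl, `A` = tent average, `c = 4`, `V = 1 − 4A†A`). [folklore] -/
def EFmat : Matrix κ κ ℝ := Cᵀ * (1 - c • (Aᵀ * A)) * C

omit [DecidableEq κ] [DecidableEq σ] in
/-- **`⟨w, EF w⟩ = ⟨Cw, Cw⟩ − c·⟨A(Cw), A(Cw)⟩`** (lens 1 (A1)'s left side `Σ|F|² − 4Σ_P|AF|²`, `F = Cw`). [folklore] -/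
theorem form_EF_eq (w : κ → ℝ) :
    w ⬝ᵥ (EFmat C A c *ᵥ w) = (C *ᵥ w) ⬝ᵥ (C *ᵥ w) - c * ((A *ᵥ (C *ᵥ w)) ⬝ᵥ (A *ᵥ (C *ᵥ w))) := by
  rw [EFmat, form_conj, Matrix.sub_mulVec, Matrix.one_mulVec, dotProduct_sub, Matrix.smul_mulVec, dotProduct_smul, smul_eq_mul,
    ← mulVec_mulVec, dotProduct_mulVec (C *ᵥ w) Aᵀ, vecMul_transpose]

omit [DecidableEq κ] in
/-- the block side: `⟨F, g(K)F⟩ − c⟨AF, AF⟩` with `g = 1 − ψ` equals `⟨F,F⟩ − c⟨AF,AF⟩ − ⟨F, ψ(K)F⟩`. [folklore] -/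
theorem form_g_eq (ψ : ℝ[X]) (F : π → ℝ) :
    F ⬝ᵥ (aeval (C * Cᵀ) (1 - ψ) *ᵥ F) = F ⬝ᵥ F - F ⬝ᵥ (aeval (C * Cᵀ) ψ *ᵥ F) := by
  rw [map_sub, map_one, Matrix.sub_mulVec, Matrix.one_mulVec, dotProduct_sub]

omit [DecidableEq σ] in
/-- the pointwise identity behind the equivalence: for `F = Cw`,
`⟨w, EF w⟩ − ⟨w, φ(CᵀC) w⟩ = ⟨F, g(CCᵀ)F⟩ − c·⟨AF, AF⟩` (`φ = X·ψ`, `g = 1 − ψ`). [folklore] -/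
theorem defect_sub_phi_eq (ψ : ℝ[X]) (w : κ → ℝ) :
    w ⬝ᵥ (EFmat C A c *ᵥ w) - w ⬝ᵥ (aeval (Cᵀ * C) (X * ψ) *ᵥ w)
      = (C *ᵥ w) ⬝ᵥ (aeval (C * Cᵀ) (1 - ψ) *ᵥ (C *ᵥ w)) - c * ((A *ᵥ (C *ᵥ w)) ⬝ᵥ (A *ᵥ (C *ᵥ w))) := by
  rw [form_EF_eq, aeval_X_mul, form_phi_eq, form_g_eq]; ring

omit [DecidableEq σ] in
/-- **TRANSPORT, ONE WAY** (the direction lens 1 uses): if the block inequality `c·⟨AF, AF⟩ ≤ ⟨F, g(CCᵀ)F⟩` holds on `ran C`, then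
`⟨w, φ(CᵀC) w⟩ ≤ ⟨w, EF w⟩` for EVERY `w`. [folklore] -/
theorem transport_of_block (ψ : ℝ[X])
    (hblock : ∀ w : κ → ℝ, c * ((A *ᵥ (C *ᵥ w)) ⬝ᵥ (A *ᵥ (C *ᵥ w))) ≤ (C *ᵥ w) ⬝ᵥ (aeval (C * Cᵀ) (1 - ψ) *ᵥ (C *ᵥ w)))
    (w : κ → ℝ) : w ⬝ᵥ (aeval (Cᵀ * C) (X * ψ) *ᵥ w) ≤ w ⬝ᵥ (EFmat C A c *ᵥ w) := by
  have h := defect_sub_phi_eq C A c ψ w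
  have hb := hblock w
  linarith

omit [DecidableEq σ] in
/-- **TRANSPORT, CONVERSELY**: the master inequality on all `w` gives the block inequality on `ran C`. [folklore] -/
theorem block_of_transport (ψ : ℝ[X])
    (hmaster : ∀ w : κ → ℝ, w ⬝ᵥ (aeval (Cᵀ * C) (X * ψ) *ᵥ w) ≤ w ⬝ᵥ (EFmat C A c *ᵥ w))
    (w : κ → ℝ) : c * ((A *ᵥ (C *ᵥ w)) ⬝ᵥ (A *ᵥ (C *ᵥ w))) ≤ (C *ᵥ w) ⬝ᵥ (aeval (C * Cᵀ) (1 - ψ) *ᵥ (C *ᵥ w)) := by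
  have h := defect_sub_phi_eq C A c ψ w
  have hm := hmaster w
  linarith

omit [DecidableEq σ] in
/-- **LENS 1's (A2) «⇔»**: `EF ≥ φ(CᵀC)` as forms on all of `ℝ^κ` IFF `c·AᵀA ≤ g(CCᵀ)` as forms on `ran C` (parametrised as `F = Cw`),
for `φ = X·ψ`, `g = 1 − ψ`, every polynomial `ψ`, every `c`. [folklore] -/
theorem transport_iff (ψ : ℝ[X]) :
    (∀ w : κ → ℝ, w ⬝ᵥ (aeval (Cᵀ * C) (X * ψ) *ᵥ w) ≤ w ⬝ᵥ (EFmat C A c *ᵥ w)) ↔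
    (∀ w : κ → ℝ, c * ((A *ᵥ (C *ᵥ w)) ⬝ᵥ (A *ᵥ (C *ᵥ w))) ≤ (C *ᵥ w) ⬝ᵥ (aeval (C * Cᵀ) (1 - ψ) *ᵥ (C *ᵥ w))) :=
  ⟨fun h => block_of_transport C A c ψ h, fun h => transport_of_block C A c ψ h⟩

omit [DecidableEq σ] in
/-- both sides kill `ker C` («gauge modes»): `φ(CᵀC) g = 0` when `C g = 0` … [folklore] -/
theorem phi_mulVec_eq_zero (ψ : ℝ[X]) {g : κ → ℝ} (hg : C *ᵥ g = 0) : aeval (Cᵀ * C) (X * ψ) *ᵥ g = 0 := by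
  rw [aeval_X_mul, phi_eq_conj, ← mulVec_mulVec, hg, mulVec_zero]

omit [DecidableEq κ] [DecidableEq σ] in
/-- … and `EF g = 0` when `C g = 0` — so «on all 1-forms» and «on phys = (gauge modes)^⊥» are the same statement for this pair. [folklore] -/
theorem EF_mulVec_eq_zero {g : κ → ℝ} (hg : C *ᵥ g = 0) : EFmat C A c *ᵥ g = 0 := by
  rw [EFmat, ← mulVec_mulVec, hg, mulVec_zero]

/-- the flat-sharp cubic's `ψ`: `ψ_flat = ½X − ⅛X²`, so `φ = X·ψ_flat = ½X² − ⅛X³ = ⅛X²(4 − X)` and `g = 1 − ψ_flat`. [folklore] -/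
def psiFlat : ℝ[X] := Polynomial.C (1 / 2) * X - Polynomial.C (1 / 8) * X ^ 2

omit [Fintype π] [DecidableEq κ] [DecidableEq σ] in
/-- evaluating `ψ_flat` and `1 − ψ_flat` at a matrix: `ψ_flat(K) = ½K − ⅛K²`, `g(K) = 1 − (½K − ⅛K²)` (file 118's `gFlat` on a diagonal
symbol). [folklore] -/
theorem aeval_psiFlat (K : Matrix π π ℝ) [Fintype π] :
    aeval K psiFlat = (1 / 2 : ℝ) • K - (1 / 8 : ℝ) • K ^ 2 ∧ aeval K (1 - psiFlat) = 1 - ((1 / 2 : ℝ) • K - (1 / 8 : ℝ) • K ^ 2) := by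
  have h : aeval K psiFlat = (1 / 2 : ℝ) • K - (1 / 8 : ℝ) • K ^ 2 := by
    unfold psiFlat
    rw [map_sub, map_mul, map_mul, aeval_C, aeval_C, aeval_X, map_pow, aeval_X, Algebra.algebraMap_eq_smul_one,
      Algebra.algebraMap_eq_smul_one, smul_mul_assoc, one_mul, smul_mul_assoc, one_mul]
  exact ⟨h, by rw [map_sub, map_one, h]⟩

omit [DecidableEq σ] [Fintype π] in
/-- `φ(H) = H·ψ_flat(H) = ½H² − ⅛H³ = ⅛·H²(4 − H)` at a matrix `H`. [folklore] -/
theorem aeval_X_mul_psiFlat (H : Matrix κ κ ℝ) :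
    aeval H (X * psiFlat) = (1 / 2 : ℝ) • H ^ 2 - (1 / 8 : ℝ) • H ^ 3 ∧
    (1 / 2 : ℝ) • H ^ 2 - (1 / 8 : ℝ) • H ^ 3 = (1 / 8 : ℝ) • (H ^ 2 * ((4 : ℝ) • 1 - H)) := by
  constructor
  · rw [aeval_X_mul, (aeval_psiFlat H).1, Matrix.mul_sub, Matrix.mul_smul, Matrix.mul_smul, pow_two, pow_succ, pow_two,
      Matrix.mul_assoc]
  · rw [pow_succ H 2, Matrix.mul_sub, Matrix.mul_smul, Matrix.mul_one, smul_sub, smul_smul]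
    norm_num

omit [DecidableEq σ] in
/-- **THE FLAT-SHARP INSTANCE**: `EF ≥ ½H² − ⅛H³ = ⅛H²(4 − H)` (`H = CᵀC`) on all of `ℝ^κ` IFF `c·⟨AF,AF⟩ ≤ ⟨F, (1 − (½K − ⅛K²))F⟩` on
`F ∈ ran C` (`K = CCᵀ`) — the hypothesis shape files 117–118 establish block by block for lens 1's symbols. [folklore] -/
theorem transport_iff_flat :
    (∀ w : κ → ℝ, w ⬝ᵥ (((1 / 2 : ℝ) • (Cᵀ * C) ^ 2 - (1 / 8 : ℝ) • (Cᵀ * C) ^ 3) *ᵥ w) ≤ w ⬝ᵥ (EFmat C A c *ᵥ w)) ↔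
    (∀ w : κ → ℝ, c * ((A *ᵥ (C *ᵥ w)) ⬝ᵥ (A *ᵥ (C *ᵥ w)))
      ≤ (C *ᵥ w) ⬝ᵥ ((1 - ((1 / 2 : ℝ) • (C * Cᵀ) - (1 / 8 : ℝ) • (C * Cᵀ) ^ 2)) *ᵥ (C *ᵥ w))) := by
  rw [← (aeval_X_mul_psiFlat (Cᵀ * C)).1, ← (aeval_psiFlat (C * Cᵀ)).2]
  exact transport_iff C A c psiFlat

end Defect

/-! ### §3 The variance identity (A1) -/

section Variance

variable (m : σ → π → ℝ)

/-- `Var_P(F) := Σ_a A_P(a)F_a² − (Σ_a A_P(a)F_a)²` for a weight row `A_P` (probability weights when `Σ_a A_P(a) = 1`). [folklore] -/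
def variance (Arow : π → ℝ) (F : π → ℝ) : ℝ := ∑ a, Arow a * F a ^ 2 - (∑ a, Arow a * F a) ^ 2

omit [DecidableEq π] in
/-- **Lagrange form**: for `Σ_a A(a) = 1`, `Var(F) = ½Σ_{a,b} A(a)A(b)(F_a − F_b)²` (lens 1: `Var_m(F) = (1∕512)Σ m(a)m(b)|F_a − F_b|²` at
`R = 16`). [folklore] -/
theorem variance_eq_half_sum_sq {Arow : π → ℝ} (hA : ∑ a, Arow a = 1) (F : π → ℝ) :
    variance Arow F = (1 / 2) * ∑ a, ∑ b, Arow a * Arow b * (F a - F b) ^ 2 := by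
  unfold variance
  have e : ∀ a b, Arow a * Arow b * (F a - F b) ^ 2
      = Arow b * (Arow a * F a ^ 2) + Arow a * (Arow b * F b ^ 2) - 2 * ((Arow a * F a) * (Arow b * F b)) := fun a b => by ring
  simp only [e, sum_sub_distrib, sum_add_distrib, ← mul_sum, ← sum_mul]
  rw [hA, sum_mul_sum]
  simp only [← mul_sum, ← sum_mul]
  ring

omit [DecidableEq π] in
/-- hence `0 ≤ Var(F)` for non-negative probability weights. [folklore] -/
theorem variance_nonneg {Arow : π → ℝ} (hA0 : ∀ a, 0 ≤ Arow a) (hA : ∑ a, Arow a = 1) (F : π → ℝ) : 0 ≤ variance Arow F := by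
  rw [variance_eq_half_sum_sq hA]
  exact mul_nonneg (by norm_num) (sum_nonneg fun a _ => sum_nonneg fun b _ =>
    mul_nonneg (mul_nonneg (hA0 a) (hA0 b)) (sq_nonneg _))

omit [DecidableEq π] [DecidableEq σ] in
/-- **THE VARIANCE IDENTITY (A1)**: for weights `m_P(a)` with constant row sum `Σ_a m_P(a) = R` and constant column sum `Σ_P m_P(a) = ν`
(partition of unity), `R, ν ≠ 0`, and `A := m∕R`:  `F·F − (R∕ν)·Σ_P (Σ_a A_P(a)F_a)² = (R∕ν)·Σ_P Var_P(F)`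
(lens 1: `R = 16`, `ν = 4`: «EF^flat(w) = Σ_a|F_a|² − 4Σ_P|AF|² = 4Σ_P Var_{m_P}(F)»). [folklore] -/
theorem variance_identity {R ν : ℝ} (hR : R ≠ 0) (hν : ν ≠ 0) (hrow : ∀ P, ∑ a, m P a = R) (hcol : ∀ a, ∑ P, m P a = ν) (F : π → ℝ) :
    F ⬝ᵥ F - (R / ν) * ∑ P, (∑ a, (m P a / R) * F a) ^ 2 = (R / ν) * ∑ P, variance (fun a => m P a / R) F := by
  have _ := hrow
  unfold variance
  rw [sum_sub_distrib, mul_sub]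
  congr 1
  -- `(R∕ν)·Σ_P Σ_a (m_P(a)∕R) F_a² = (R∕ν)·Σ_a ((Σ_P m_P(a))∕R) F_a² = Σ_a F_a²`
  rw [sum_comm]
  have e : ∀ a, ∑ P, m P a / R * F a ^ 2 = ν / R * F a ^ 2 := fun a => by rw [← sum_mul, ← sum_div, hcol]
  simp only [e]
  rw [← mul_sum, ← mul_assoc, show R / ν * (ν / R) = 1 by field_simp, one_mul, dotProduct]
  exact sum_congr rfl fun a _ => by ring

omit [DecidableEq π] [DecidableEq σ] in
/-- the averaging matrix `A_P(a) = m_P(a)∕R` applied: `(A F)_P = Σ_a A_P(a) F_a` and `⟨AF, AF⟩ = Σ_P (AF)_P²`. [folklore] -/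
theorem avg_dot_self (R : ℝ) (F : π → ℝ) :
    (Matrix.of (fun P a => m P a / R) *ᵥ F) ⬝ᵥ (Matrix.of (fun P a => m P a / R) *ᵥ F) = ∑ P, (∑ a, (m P a / R) * F a) ^ 2 := by
  simp only [dotProduct, mulVec, Matrix.of_apply, sq]

omit [DecidableEq κ] [DecidableEq σ] in
/-- **POSITIVITY OF THE FLAT DEFECT FORM (A1)**: with `A = m∕R` as above and `c = R∕ν`, `0 ≤ ⟨w, EF w⟩ = (R∕ν)Σ_P Var_P(Cw)` for every `w`.
[folklore] -/
theorem form_EF_nonneg (C : Matrix π κ ℝ) {R ν : ℝ} (hR : 0 < R) (hν : 0 < ν) (hm : ∀ P a, 0 ≤ m P a)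
    (hrow : ∀ P, ∑ a, m P a = R) (hcol : ∀ a, ∑ P, m P a = ν) (w : κ → ℝ) :
    w ⬝ᵥ (EFmat C (Matrix.of fun P a => m P a / R) (R / ν) *ᵥ w)
      = (R / ν) * ∑ P, variance (fun a => m P a / R) (C *ᵥ w) ∧
    0 ≤ w ⬝ᵥ (EFmat C (Matrix.of fun P a => m P a / R) (R / ν) *ᵥ w) := by
  have h : w ⬝ᵥ (EFmat C (Matrix.of fun P a => m P a / R) (R / ν) *ᵥ w) = (R / ν) * ∑ P, variance (fun a => m P a / R) (C *ᵥ w) := by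
    rw [form_EF_eq, avg_dot_self, variance_identity m hR.ne' hν.ne' hrow hcol]
  refine ⟨h, ?_⟩
  rw [h]
  refine mul_nonneg (div_pos hR hν).le (sum_nonneg fun P _ => variance_nonneg (fun a => div_nonneg (hm P a) hR.le) ?_ _)
  rw [← sum_div, hrow P, div_self hR.ne']

end Variance

end Summit.QuantumFields.BalabanUV.T4Continuum.NE7EJFlatTransport

end
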